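import Summits.NavierStokesRegularity.FluidComputer.DesignedBlowupSerrinDivergence
import Summits.NavierStokesRegularity.FluidComputer.DesignedBlowupRegularity
import Literature.Analysis.FluidPDE.TaoForcedBoundedSobolevNormsOfLocalExistence
import Literature.Analysis.FluidPDE.NSForcedH1ContinuationOfLocalExistence
import HarnessLib

/-!
# The Sohr corner for a designed forced blow-up, modulo Tao's forced local theory ALONE

Cell `ns-blowup`, seat `ns-blowup-ecbridge-2` (g4; the E–C endpoint theory seat). LABEL: E–C typing
(KERNEL modulo ONE named fact, F2 = `tao2011_smooth_local_existence_forced`). WHAT THIS IS NOT: not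
Navier–Stokes evidence — necessary conditions on the TYPE `DesignedBlowup`. Companion memo:
`run/shared/lean/pub/ns-blowup/ecbridge2/ECBRIDGE-2-MEMO-3.md` §2 (trust base).

## Content (row R2 / T23 «velocity outside every LPS class near T*» with the smallest trust base)

`DesignedBlowupSerrinDivergence.lean` (this seat, p432022) proved the Sohr corner, the `H¹`
alternative and the Type-II floor for `DesignedBlowup ν` modulo the printed facts hC (LR16 Thm. 7.2
with force) and J1 (Tao 2013 Cor. 11.1 + Thm. 5.4 (iv) with force). Both are now THEOREMS modulo F2
in the Literature tree (`lemarieRieusset2016_H1_continuation_forced_of_smooth_local_existence`,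
`tao2011_hasBoundedSobolevNormsOn_forced_of_smooth_local_existence`, 2026-08-26), and Tao's spatial
class of a designed blow-up is fact-free (`DesignedBlowup.hasBoundedSobolevNormsOn`, p432448). Hence:

* **`DesignedBlowup.lintegral_serrin_eq_top_of_F2`** — for a design with Tao-NORMALISED pressure
  (`HasForcedNormalisedPressure u f p [0,T)`, the natural choice in style (β′)) and `ν > 0`, GIVEN F2
  only: `∫₀ᵀ ‖u(t)‖_{L^r}^{2/(1−3/r)} dt = ∞` for EVERY `3 < r ≤ ∞`;
* **`DesignedBlowup.not_subTypeI_of_F2`** — same hypotheses: no rate `‖u(t)‖_∞ ≤ C(T−t)^{−γ}`,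
  `γ < 1/2`;
* `DesignedBlowup.lintegral_serrin_eq_top_of_F2'` / `not_subTypeI_of_F2'` — for an ARBITRARY
  Tao-class pressure `p'` (classes of `∂ₜu`, `p'` as hypotheses; `u`'s class fact-free), GIVEN F2.

Trust base of MEMO-1 rows R2 / H¹-alternative / Type-II floor on the generic E–C object: {F2}.

References: T. Tao, Anal. PDE 6 (2013) = arXiv:1108.1165, Thm. 5.4, Cor. 11.1 [cite: Tao2011, Thm. 5.4];
P. G. Lemarié-Rieusset (2016), Thm. 7.2, Thm. 11.2 (11.11) [cite: LemarieRieusset2016, Thm. 11.2];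
H. Sohr (2001), Thm. V.1.8.1 [cite: Sohr2001, Thm. V.1.8.1]; C. L. Fefferman, Clay problem (C)
[cite: FeffermanClay2006, (C)].
-/

noncomputable section

namespace Summit.NavierStokesRegularity.FluidComputer

namespace DesignedBlowup

open Set MeasureTheory Filter Topology Function
open scoped ENNReal NNReal
open Literature.Analysis.FluidPDE

variable {ν : ℝ} (D : DesignedBlowup ν)

/-- **The Sohr corner for a design with normalised pressure, GIVEN F2 only**: the velocity of a
designed forced blow-up (`ν > 0`, pressure `p = −Δ⁻¹∂ᵢ∂ⱼ(uᵢuⱼ) + Δ⁻¹∇·f` on `[0, T)`) leaves every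
Ladyzhenskaya–Prodi–Serrin class at `T`: `∫₀ᵀ ‖u(t)‖_{L^r}^{2/(1−3/r)} dt = ∞`, `3 < r ≤ ∞`.
[cite: LemarieRieusset2016, Thm. 11.2] [cite: Sohr2001, Thm. V.1.8.1] [cite: Tao2011, Thm. 5.4] -/
theorem lintegral_serrin_eq_top_of_F2 (hF : tao2011_smooth_local_existence_forced) (hν : 0 < ν)
    (hnorm : HasForcedNormalisedPressure D.u D.f D.p (Ico 0 D.T)) {r : ℝ≥0∞} (hr : 3 < r) :
    ∫⁻ t in Ioo 0 D.T,
        ENNReal.ofReal ((eLpNorm (D.u t) r volume).toReal ^ (2 / (1 - (3 / r).toReal))) = ⊤ :=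
  D.lintegral_serrin_eq_top_of_normalisedPressure
    (tao2011_hasBoundedSobolevNormsOn_forced_of_smooth_local_existence hF)
    (lemarieRieusset2016_H1_continuation_forced_of_smooth_local_existence hF) hν hnorm hr

/-- **Not sub-Type-I, for a design with normalised pressure, GIVEN F2 only.**
[cite: LemarieRieusset2016, Thm. 11.2] [cite: Tao2011, Thm. 5.4] -/
theorem not_subTypeI_of_F2 (hF : tao2011_smooth_local_existence_forced) (hν : 0 < ν)
    (hnorm : HasForcedNormalisedPressure D.u D.f D.p (Ico 0 D.T))
    {C γ : ℝ} (hCγ : 0 ≤ C) (hγ : γ < 1 / 2)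
    (hrate : ∀ t ∈ Ioo 0 D.T, eLpNorm (D.u t) ⊤ volume ≤ ENNReal.ofReal (C * (D.T - t) ^ (-γ))) :
    False :=
  D.not_subTypeI_of_normalisedPressure
    (tao2011_hasBoundedSobolevNormsOn_forced_of_smooth_local_existence hF)
    (lemarieRieusset2016_H1_continuation_forced_of_smooth_local_existence hF) hν hnorm hCγ hγ hrate

/-- **The Sohr corner with an arbitrary Tao-class pressure `p'`, GIVEN F2**: `(u, p')` classical on
`[0, T)`, `∂ₜu` and `p'` in Tao's class on closed sub-slabs (hypotheses; the class of `u` itself is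
fact-free, `hasBoundedSobolevNormsOn_subslabs`). [cite: LemarieRieusset2016, Thm. 11.2]
[cite: Tao2011, Thm. 5.4] -/
theorem lintegral_serrin_eq_top_of_F2' (hF : tao2011_smooth_local_existence_forced) (hν : 0 < ν)
    {p' : ℝ → EuclideanSpace ℝ (Fin 3) → ℝ}
    (hsol : IsClassicalNSSolutionOn (Ico 0 D.T) ν D.f D.u p')
    (hut : ∀ T' ∈ Ioo 0 D.T, HasBoundedSobolevNormsOn (Icc 0 T') (timeDerivWithin (Icc 0 T') D.u))
    (hp : ∀ T' ∈ Ioo 0 D.T, ∀ n : ℕ, ∃ C : ℝ≥0, ∀ t ∈ Icc 0 T',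
      ∫⁻ x, ‖iteratedFDeriv ℝ n (p' t) x‖ₑ ^ 2 ≤ C)
    {r : ℝ≥0∞} (hr : 3 < r) :
    ∫⁻ t in Ioo 0 D.T,
        ENNReal.ofReal ((eLpNorm (D.u t) r volume).toReal ^ (2 / (1 - (3 / r).toReal))) = ⊤ :=
  D.lintegral_serrin_eq_top (lemarieRieusset2016_H1_continuation_forced_of_smooth_local_existence hF)
    hν hsol (D.hasBoundedSobolevNormsOn_subslabs hν) hut hp hr

/-- **Not sub-Type-I with an arbitrary Tao-class pressure `p'`, GIVEN F2.**
[cite: LemarieRieusset2016, Thm. 11.2] [cite: Tao2011, Thm. 5.4] -/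
theorem not_subTypeI_of_F2' (hF : tao2011_smooth_local_existence_forced) (hν : 0 < ν)
    {p' : ℝ → EuclideanSpace ℝ (Fin 3) → ℝ}
    (hsol : IsClassicalNSSolutionOn (Ico 0 D.T) ν D.f D.u p')
    (hut : ∀ T' ∈ Ioo 0 D.T, HasBoundedSobolevNormsOn (Icc 0 T') (timeDerivWithin (Icc 0 T') D.u))
    (hp : ∀ T' ∈ Ioo 0 D.T, ∀ n : ℕ, ∃ C : ℝ≥0, ∀ t ∈ Icc 0 T',
      ∫⁻ x, ‖iteratedFDeriv ℝ n (p' t) x‖ₑ ^ 2 ≤ C)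
    {C γ : ℝ} (hCγ : 0 ≤ C) (hγ : γ < 1 / 2)
    (hrate : ∀ t ∈ Ioo 0 D.T, eLpNorm (D.u t) ⊤ volume ≤ ENNReal.ofReal (C * (D.T - t) ^ (-γ))) :
    False :=
  D.not_subTypeI (lemarieRieusset2016_H1_continuation_forced_of_smooth_local_existence hF) hν hsol
    (D.hasBoundedSobolevNormsOn_subslabs hν) hut hp hCγ hγ hrate

end DesignedBlowup

end Summit.NavierStokesRegularity.FluidComputer

end
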